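import Summits.ABC.IUTFork.Repair.CandJoshi23
import Summits.ABC.IUTFork.Repair.CandJoshi21
import HarnessLib

/-!
# IUT REPAIR BRANCH (LADDER-ABC:A2.RP), class (iii) JOSHI, j2 — TESTS of the VALUE-CHART scaling model `CandJoshi23`, I: the move undoing
# Joshi's law `v_{K_2} = 4·v_{K_1}`, honest volumes, H_J21-2 by a NON-identity move, the residual, H_J21-5, Step (x) (volumes move, Adm does not)

Record file of the abc-iut cell's IUT REPAIR BRANCH (seat abc-iut-rp-j2, gen 2; row RP-J05 door (a): H_J21-2 `JoshiScalingIndeterminacy`,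
H_J21-5 `JoshiNonIsometricIndeterminacy` of `Repair/CandJoshi21`, p427435; model `Repair/CandJoshi23`, p437744). TAKES NO SIDE on [IUTchIII]
Cor. 3.12 or on any author. PROOF-ONLY but for the packet-automorphism families `headFam`/`jMove` (no `Prop` def, no `Prop` fact);
interface-level toy over `toyIndex`; typed ≠ proved ≠ endorsed.
RESULTS (over `valSetting p`, `vRho p`, `vQDatum p`, every prime `p`). §1 `headFam c`: the (Ind2)-family «multiply the last tensor factor at
label `j` by `c_j > 0`» (line scalar EXACTLY `c_j`; w4-d098's `sFamDep` gives `c_j^{j+1}`, never `1/4`) and THE MOVE `jMove := headFam (1,1,¼)`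
= Joshi's law `v_{K_2} = 2²·v_{K_1}` (arXiv:2303.01662 Thm. 6.9.1 (3)) undone at label `2`; `starAut_jMove_vPsi`: `jMove · (j²)_j = (1)_j`.
§2 honest volumes (`val_qLocal = −log p` label-independently, `val_hscaled` exact `j²`). §3 H_J21-2 HOLDS by the NON-identity `jMove` (`val_H2`,
folded), hence the residual (`val_residual`, by abc-iut-rp-j2's (T-a) `pilotKummerIndRelated_of_scalingIndeterminacy`) and R3 / `GapA″` / `GapA3`
(`val_reading3`, `val_gapA3`); H_J21-5 HOLDS (`val_H5`: `jMove : H_4 ↦ H_1`, `−4·log p ↦ −log p`); Step (x) log-volume invariance FAILS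
(`val_not_logvolInvariant`) while Step (x) ADMISSIBILITY-invariance HOLDS (`val_hAdm`): of the hypotheses of abc-iut-w4-d103's ∀-form
`PinnedHonest.not_gapA''_of_scaledAt` exactly ONE (`hvol`) fails here — as it must, `GapA″` being TRUE here. The price sheet (ThetaFinite,
`−|log(Θ)| = 0`, Statement, BridgeHyps, no constant modulus) and the packaged (T-c) existential are the sequel `CandJoshi23Price`.
[claim: Mochizuki2012, status: disputed] [claim: Joshi2023ATS2Local, status: disputed] [claim: Joshi2021ATS1, status: disputed]
-/

noncomputable section

open Set

namespace Summit.ABC.IUTFork.Repair.CandJoshi23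

open Thm311 Cor312 Cor312.Checks Cor312.IdentifiedNonVacuity Cor312Vol Cor312Vol.NaiveWitness Cor312Vol.UnitWitness
  Cor312Vol.PinnedWitness Literature.IUT.LogThetaLattice Summit.ABC.IUTFork.Repair Summit.ABC.IUTFork.Repair.ScalarShells
  Summit.ABC.IUTFork.Repair.ScalarShellsThm311

variable (p : ℕ)

/-! ## 1. Single-factor scalar families; the move `jMove` undoing `v ↦ 4v` at label `2` -/

/-- The scalar placed on the LAST tensor factor at label `j` (`1` on the others). [folklore] -/
def lastScalar (c : toyIndex.Label → ℚˣ) (j : toyIndex.Label) (i : toyIndex.Caps j) : ℚˣ :=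
  if i = toyIndex.selfIndex j then c j else 1

/-- **`headFam c`** — the (Ind2)-family «at label `j`, multiply the last tensor factor by `c_j`» (independent copies of "Ism" on the
factors, [IUTchIII] Thm. 3.11 (i) (Ind2), here with all but one copy trivial). [claim: Mochizuki2012, status: disputed] -/
def headFam (c : toyIndex.Label → ℚˣ) : (valShells p).PacketAut := fun j vQ =>
  (valShells p).factorwise j vQ fun i =>
    (valShells p).summandwise vQ fun _ => mulEquiv (lastScalar c j i : ℚ) (lastScalar c j i).ne_zero

variable {p} in
/-- For positive `c`, `headFam c` is an (Ind2)-family of the value-chart shells. [folklore] -/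
theorem headFam_mem_Ind2Family {c : toyIndex.Label → ℚˣ} (hc : ∀ j, c j ∈ posScalars) :
    headFam p c ∈ (valShells p).Ind2Family := fun j vQ =>
  ⟨fun i _ => mulEquiv (lastScalar c j i : ℚ) (lastScalar c j i).ne_zero,
    fun i _ => mulEquiv_mem_scalarAuts posScalars (by unfold lastScalar; split_ifs; exacts [hc j, Subgroup.one_mem _]), rfl⟩

/-- The product of the factor scalars at label `j` is `c_j`. [folklore] -/
theorem prod_lastScalar (c : toyIndex.Label → ℚˣ) (j : toyIndex.Label) :
    (∏ i : toyIndex.Caps j, (lastScalar c j i : ℚ)) = (c j : ℚ) := by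
  rw [Finset.prod_eq_single (toyIndex.selfIndex j)]
  · simp [lastScalar]
  · intro i _ hi
    simp [lastScalar, hi]
  · intro h
    exact absurd (Finset.mem_univ _) h

/-- On the packet line at label `j`, `headFam c` is EXACTLY the scalar `c_j` (multilinearity). [folklore] -/
theorem line_headFam (c : toyIndex.Label → ℚˣ) (j : toyIndex.Label) (vQ : toyIndex.VQ) (x : (valShells p).Packet j vQ) :
    line j vQ (headFam p c j vQ x) = (c j : ℚ) * line j vQ x := by
  have h := line_factorwise_of_smul j vQ
    (fun i => (valShells p).summandwise vQ fun _ => mulEquiv (lastScalar c j i : ℚ) (lastScalar c j i).ne_zero)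
    (fun i => (lastScalar c j i : ℚ)) (fun _ y => by funext v; rfl) x
  rw [prod_lastScalar] at h
  exact h

/-- `1/4` as a unit of `ℚ`. [folklore] -/
def quarter : ℚˣ := Units.mk0 (4⁻¹ : ℚ) (by norm_num)

/-- **Joshi's law undone, label by label**: the scalar vector `cJ := (1, 1, 1/4)` — at label `2` the valuation law `v ↦ v/4` (the inverse of
`v_{K_2} = 2²·v_{K_1}`, arXiv:2303.01662 Thm. 6.9.1 (3)), the identity at labels `0, 1`. [claim: Joshi2023ATS2Local, status: disputed] -/
def cJ : toyIndex.Label → ℚˣ := fun j => if (j : ℕ) = 2 then quarter else 1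

/-- `cJ` is positive. [folklore] -/
theorem cJ_mem (j : toyIndex.Label) : cJ j ∈ posScalars := by
  unfold cJ
  split_ifs
  · exact (Units.mem_posSubgroup _).2 (by show (0 : ℚ) < 4⁻¹; norm_num)
  · exact Subgroup.one_mem _

/-- The label `2 ∈ 𝔽_l^⋇` of `toyIndex` has value `2`. [folklore] -/
theorem label_two_val : ((2 : toyIndex.Label) : ℕ) = 2 := by decide

/-- At label `2` the scalar is `1/4`. [folklore] -/
theorem cJ_two : ((cJ (2 : toyIndex.Label) : ℚˣ) : ℚ) = 4⁻¹ := by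
  unfold cJ
  rw [if_pos label_two_val]
  rfl

/-- **THE MOVE `jMove := headFam cJ`**. [claim: Joshi2023ATS2Local, status: disputed] -/
def jMove : (valShells p).PacketAut := headFam p cJ

/-- `jMove` is an (Ind2)-family … [folklore] -/
theorem jMove_mem_Ind2Family : jMove p ∈ (valShells p).Ind2Family := headFam_mem_Ind2Family cJ_mem

/-- … hence an element of `⟨(Ind1) ∪ (Ind2)⟩`. [folklore] -/
theorem jMove_mem_closure : jMove p ∈ Subgroup.closure ((valShells p).Ind1Family ∪ (valShells p).Ind2Family) :=
  Subgroup.subset_closure (Or.inr (jMove_mem_Ind2Family p))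

/-- `cJ_j · j² = 1` at both labels of `𝔽_l^⋇` (`1·1`, `¼·4`). [folklore] -/
theorem cJ_mul_jsq (j : toyIndex.LabelStar) : (cJ j.1 : ℚ) * (jsq j.1 : ℚ) = 1 := by
  rcases labelStar_val_cases j with hj | hj <;> norm_num [cJ, jsq, hj, quarter]

/-- **`jMove` carries the Θ-datum `(j²)_j` ONTO the q-datum `(1)_j`** — inside the indeterminacy group of the value chart the Θ-pilot's and the
q-pilot's Kummer data are RELATED (what no sign/unit indeterminacy does). [folklore] -/
theorem starAut_jMove_vPsi (v : toyIndex.V) (hv : v ∈ toyIndex.Vbad) :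
    (valShells p).starAut (jMove p) v '' vPsi p v = vQDatum p v hv := by
  have key : ∀ (f : (valShells p).StarPacket v) (j : toyIndex.LabelStar),
      line j.1 (toyIndex.over v) ((valShells p).starAut (jMove p) v f j) = (cJ j.1 : ℚ) * line j.1 (toyIndex.over v) (f j) :=
    fun f j => line_headFam p cJ j.1 (toyIndex.over v) (f j)
  apply Set.Subset.antisymm
  · rintro _ ⟨f, hf, rfl⟩ j
    rw [key, hf j, cJ_mul_jsq]
  · intro g hg
    refine ⟨((valShells p).starAut (jMove p) v).symm g, fun j => ?_, LinearEquiv.apply_symm_apply _ _⟩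
    have h1 := key (((valShells p).starAut (jMove p) v).symm g) j
    rw [LinearEquiv.apply_symm_apply, hg j] at h1
    apply mul_left_cancel₀ (cJ j.1).ne_zero
    rw [← h1, cJ_mul_jsq]

/-- At label `2`, `jMove` carries `H_a` onto `H_{a/4}`. [folklore] -/
theorem image_vHalf_jMove_two (a : ℚ) : jMove p 2 () '' vHalf p 2 () a = vHalf p 2 () (4⁻¹ * a) :=
  image_vHalf_of_line_eq p (jMove p 2 ()) (by norm_num) (fun x => by
    rw [show jMove p 2 () x = headFam p cJ 2 () x from rfl, line_headFam, cJ_two]) a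

/-! ## 2. Honest volumes -/

/-- The local q-term at every label of `𝔽_l^⋇` is `μ(H_1) = −log p` (label-INDEPENDENT). [folklore] -/
theorem val_qLocal (i : Fin toyIndex.lstar) (vQ : toyIndex.VQ) :
    (valSetting p).qLocal (Setting.labelSucc i) vQ = -Real.log p := by
  show vVol p _ vQ ((valSetting p).qRegion (Setting.labelSucc i) vQ) = _
  rw [valSetting_qRegion, if_neg (Setting.labelSucc_ne_zero i), vVol_vHalf]
  push_cast; ring

/-- `−|log(q)| = −log p`. [folklore] -/
theorem val_negLogQ : (valSetting p).negLogQ = -Real.log p := by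
  unfold Setting.negLogQ
  have h : (fun i : Fin toyIndex.lstar => ∑ᶠ vQ : toyIndex.VQ, (valSetting p).qLocal (Setting.labelSucc i) vQ) =
      fun _ => -Real.log p := by
    funext i; rw [finsum_unique]; exact val_qLocal p _ _
  rw [h]
  exact processionNormalized_const (by decide) _

/-- **HONEST `j²`-SCALING in every packet of `𝔽_l^⋇`**: `μ(ρ Ψ_n at label j) = μ(H_{j²}) = j²·μ(H_1) = j²·qLocal`. [folklore] -/
theorem val_hscaled (i : Fin toyIndex.lstar) (vQ : toyIndex.VQ) :
    ((vFull p).D (valSetting p).n).logvol _ vQ (vRho p ((vFull p).D (valSetting p).n).Ψ (Setting.labelSucc i) vQ) =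
      (((i : ℕ) + 1 : ℕ) : ℝ) ^ 2 * (valSetting p).qLocal (Setting.labelSucc i) vQ := by
  have hΨ : ((vFull p).D (valSetting p).n).Ψ = fun v _ => vPsi p v := rfl
  rw [hΨ, vRho_vPsi, val_qLocal]
  show vVol p _ vQ (vHalf p _ vQ (jsq (Setting.labelSucc i) : ℚ)) = _
  rw [vVol_vHalf]
  have hj : ((jsq (Setting.labelSucc i) : ℚ) : ℝ) = (((i : ℕ) + 1 : ℕ) : ℝ) ^ 2 := by
    unfold jsq
    rw [show ((Setting.labelSucc i : toyIndex.Label) : ℕ) = (i : ℕ) + 1 from Fin.val_succ i]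
    push_cast; ring
  rw [hj]; ring

/-! ## 3. H_J21-2 by a non-identity move, the residual, H_J21-5; Step (x): volumes move, admissibility does not -/

/-- **H_J21-2 `JoshiScalingIndeterminacy` HOLDS in the value chart**, witnessed by `jMove` (not the identity). [claim: Joshi2023ATS2Local, status: disputed] -/
theorem val_H2 : JoshiScalingIndeterminacy (vFull p).toLatticeSituation (valSetting p) (vQDatum p) :=
  ⟨jMove p, jMove_mem_closure p, fun v hv => (starAut_jMove_vPsi p v hv).symm⟩

/-- **The residual `PilotKummerIndRelated` HOLDS in the value chart** (abc-iut-rp-j2's (T-a) `pilotKummerIndRelated_of_scalingIndeterminacy`).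
[claim: Mochizuki2012, status: disputed] -/
theorem val_residual : PilotKummerIndRelated (vFull p).toLatticeSituation (valSetting p) (vRho p) (vQDatum p) :=
  pilotKummerIndRelated_of_scalingIndeterminacy _ _ _ _ (val_H2 p)

/-- … hence READING R3 (the q-pilot region is a possible image of the Θ-pilot at every `(j, v_ℚ)`; abc-iut-w5-d230). [claim: Mochizuki2012, status: disputed] -/
theorem val_reading3 (j : toyIndex.Label) (vQ : toyIndex.VQ) : (valSetting p).qRegion j vQ ∈ (valSetting p).possibleImages j vQ :=
  (reading3_iff_pilotKummerIndRelated _ _ _ _ (val_kummerB p 0) (val_pinnedRegions3 p).1).2 (val_residual p) j vQ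

/-- … so `GapA″` and `GapA3` HOLD here (non-vacuously: the pins hold). [claim: Mochizuki2012, status: disputed] -/
theorem val_gapA3 : GapA'' (vFull p).toLatticeSituation (valSetting p) (vRho p) (vQDatum p) ∧
    GapA3 (vFull p).toLatticeSituation (valSetting p) (vRho p) (vQDatum p) :=
  ⟨fun _ => val_reading3 p, fun _ => val_reading3 p⟩

variable [hp : Fact p.Prime]

/-- `jMove` CHANGES the log-volume of the Θ-region `H_4` at label `2` (`−4·log p ↦ −log p`). [folklore] -/
theorem vVol_jMove_theta_ne : vVol p 2 () (jMove p 2 () '' vHalf p 2 () 4) ≠ vVol p 2 () (vHalf p 2 () 4) := by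
  rw [image_vHalf_jMove_two, vVol_vHalf, vVol_vHalf]
  have := log_p_pos p
  push_cast
  nlinarith

/-- **H_J21-5 `JoshiNonIsometricIndeterminacy` HOLDS in the value chart**: the very move that relates the pilots is not an isometry.
[claim: Joshi2021ATS1, status: disputed] -/
theorem val_H5 (n : ℤ) : JoshiNonIsometricIndeterminacy (vSituation p) n :=
  ⟨jMove p, jMove_mem_closure p, 2, (), vHalf p 2 () 4, ⟨4, rfl⟩, vVol_jMove_theta_ne p⟩

/-- **Step (x) log-volume invariance (abc-iut-c312-1's `MRData.LogvolInvariant`, w4-d103's `hvol`) FAILS** for the value-chart data. [folklore] -/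
theorem val_not_logvolInvariant : ¬ (vData p).LogvolInvariant := fun h =>
  vVol_jMove_theta_ne p (h (jMove p) (Or.inr (jMove_mem_Ind2Family p)) 2 () (vHalf p 2 () 4) ⟨4, rfl⟩)

omit hp in
/-- **… while Step (x) ADMISSIBILITY-invariance (w4-d103's `hAdm`) HOLDS**: the generators carry half-lines to half-lines, both ways. [folklore] -/
theorem val_hAdm : ∀ Φ ∈ (valShells p).Ind1Family ∪ (valShells p).Ind2Family,
    ∀ (j : toyIndex.Label) (vQ : toyIndex.VQ) (B : Set ((valShells p).Packet j vQ)),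
      (vData p).Adm j vQ B ↔ (vData p).Adm j vQ (Φ j vQ '' B) := by
  intro Φ hΦ j vQ B
  obtain ⟨u, hu, hΦc⟩ := (ScalarShells.actsByScalars_of_mem_closure (Subgroup.subset_closure hΦ)).scalar j vQ
  have hu0 : (0 : ℚ) < u := (Units.mem_posSubgroup _).1 hu
  constructor
  · rintro ⟨a, rfl⟩
    exact ⟨u * a, image_vHalf_of_line_eq p (Φ j vQ) hu0 hΦc a⟩
  · rintro ⟨b, hb⟩
    have hsymm : ∀ y, line j vQ ((Φ j vQ).symm y) = (u : ℚ)⁻¹ * line j vQ y := fun y => by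
      have h1 := hΦc ((Φ j vQ).symm y)
      rw [LinearEquiv.apply_symm_apply] at h1
      rw [h1, ← mul_assoc, inv_mul_cancel₀ u.ne_zero, one_mul]
    have hB : B = (Φ j vQ).symm '' (Φ j vQ '' B) := by
      rw [Set.image_image]; simp
    refine ⟨(u : ℚ)⁻¹ * b, ?_⟩
    rw [hB, hb]
    exact image_vHalf_of_line_eq p (Φ j vQ).symm (inv_pos.2 hu0) hsymm b

end Summit.ABC.IUTFork.Repair.CandJoshi23

end
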